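import Mathlib
import Summits.Ventures.FusionMHD.Models.CerfonFreidbergIterLikeQHalfMercDefs
import HarnessLib

/-!
# Ventures/FusionMHD — Models/CerfonFreidbergIterLikeQHalfMercPanels18.lean: KERNEL CHECK of the Mercier-register certificates of panel(s) 30 (of 32)
# at `ψ_N = 1/2` of THE Cerfon–Freidberg ITER-like instance

HONEST FRAMING (LADDER-GRIDFUSION three columns; CF rung; «F2.R2-CF-MERCIER-IMPLICIT» step (2), F2-SCOPING v1.6 §10(c)).  One `decide +kernel` (≈ 70 s): for each
listed panel the obligation `CFIterLike.QHalfMerc.MercCert.ok` (`Models/CerfonFreidbergIterLikeQHalfMercDefs.lean`) — the Taylor-model run of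
`progM = progA ++ block1 ++ block2 ++ block3M` over ★ #117's parameter box is ACCEPTED (both `inv` certificates included) and the kernel's FOUR panel-integral
enclosures (`g_W`, `g_Aσ`, `g_AR`, `g_B1` along the approximant) lie inside the claimed integers (read off a compiled `#eval` of the same functions, slack one unit of
`2⁻⁶⁰`; float truth inside every panel, `HOME/models/model-7/g7/genqm/truthM.json`).  MODELLED: analytic Cerfon–Freidberg family; nothing about a device or
stability.  No `native_decide`.  Typer/prover: gridfusion-model-7 (g7), 2026-08-27.
Citations: Jardin 2010 §8.5 (8.134) [Jardin2010]; Mahboubi–Melquiond–Sibut-Pinote 2016 §3.2 Lemma 3 [MahboubiMelquiondSibutpinote2016].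
-/

namespace Summit.Ventures.FusionMHD.Models.CFIterLike.QHalfMerc

/-- Mercier-register certificate data of panel(s) 30. [instance data] -/
def mercCert18 : List MercCert := [
  { j := 30, cand1 := [770286583785756819456, -901700155134050566144, 10156892089973989179392, -11650597357616065675264, 66280321698044483469312, -51578477062413818527744, 154305697342915644227584, 331146421529519432138752, -1189807562257256106950656, 8617298446212839187152896, -2340586439724290815253544960, 130966184841000560732667904, 3167405478962240472012684263424],
    cand2 := [611557891446695002112, -432504888732044754944, 4867742021457654317056, -5552596332986606026752, 33030660595950337130496, -45183452697286898876416, 186678494825537104510976, -243810237538507461492736, 728632562566114645639168, -1998223487733706939957248, 73716304057615988379615232, 3799203098980619726803173376, -170554303045167744279656792064],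
    deg := 12, e1 := 43, e2 := 42, wlo := 499094676787183571, whi := 499094715181149618, slo := 9492777017770337042, shi := 9492777176615074527,
    rlo := 6127034843551731988, rhi := 6127034951458426945, blo := 14707417062311999214, bhi := 14707417295529145983 }]

/-- **KERNEL CHECK** of the four Mercier registers on panel(s) 30. -/
theorem mercCert18_ok : CFIterLike.QHalfMerc.mercCert18.all MercCert.ok = true := by
  decide +kernel

end Summit.Ventures.FusionMHD.Models.CFIterLike.QHalfMerc
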